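import Summits.AtomisticToContinuum.HydrodynamicLimit.Theorems.InformationPercolationEngineChaosClosesEulerShellFieldB
import HarnessLib

/-!
# BF18 shell for functions (crux `ChaosClosesEuler`, stmt-AtomisticToContinuum-15141, line `Sketch`,
# stub `stub_bf18Shell`) — the shell field's slice functions, part 3 (`stub_bf18ShellFieldC`)

WHAT. Continuation of `…ChaosClosesEulerShellField(B)` (same setting: a measurable bounded shell field
`V = (ϱ, m, E) : ℝ → 𝕋³ → ℝ × E³ × ℝ`, `ϱ, E ≥ 0`, `|m|² ≤ 2ϱE`, `|ϱ|, |m|, |E| ≤ CV`, against a classical solution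
`(ρ, u, θ)` on `[0, T)` for `eos = EulerEOS.monatomicExcess χe f`, point data `pdAt T ρ u θ`, shell state
`w(V s x) = (ϱ, E - |m|²/(2ϱ), m)`, cold/warm selected cut-off, `S = [0, t'] × 𝕋³`, `t' < T`):

* `slices_relEnergy`, `slices_rawRHS`: the slice functions of `ℰ` and of `rawRHS + div(p̃ũ)` — integrable slices
  with explicit bounds for `s ∈ [0, t']`, `s ↦ ∫ₓ` integrable on `[0, t']`; `exists_measurable_relEnergy`: a
  measurable version of `F(s) = ∫ₓ ℰ(s, x)`;
* the SPLITTING IDENTITIES `integral_relEnergy_split`: `∫ₓ ℰ = ∫ₓ E - ∫ₓ ũ·m + ∫ₓ φ₁ϱ - ∫ₓ θ̃ϱZs + ∫ₓ p̃`, and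
  `integral_rawRHS_split`: `∫ₓ rawRHS = -∫ₓ (H2) + ∫ₓ contI - ∫ₓ (H3) + ∫ₓ ∂ₜp̃`,
  `∫ₓ (rawRHS + div) = ∫ₓ rawRHS + ∫ₓ div` (pointwise `relEnergyZ_shell_sel`, `rawRHS_shell_pieces` with `momI`,
  `entI` identified by `field_momI`, `field_entI`, then `∫ (f ± g) = ∫ f ± ∫ g` with the slice integrabilities);
* the order consequences `integral_le_const_mul_integral` (= the registered `stub_bf18ShellFieldC`),
  `integral_rawRHS_le`: `∫ₓ (rawRHS + div) ≤ C' ∫ₓ ℰ` from the pointwise inequality, `integral_relEnergy_nonneg`;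
* `integrableOn_pieces`: integrability on `[0, t']` of the slice integrals of all ten pieces.

WHY. The two bookkeeping identities and the integrabilities through which the assembly of `stub_bf18Shell` feeds
`F(s) = XE - XM + XC - XS + XP` and `Rp = -GM + GC - GS + GP + GD` into the weighted bookkeeping
(`stub_bf18ShellWin`) and the windowed Grönwall lemma.

No named fact is invoked.
-/

noncomputable section

namespace Summit.AtomisticToContinuum.HydrodynamicLimit.Theorems.ChaosClosesEulerShellFieldC

open Set MeasureTheory Function Literature.Analysis.FluidPDE Literature.Analysis.FluidPDE.CompressibleEuler
  Literature.Analysis.FluidPDE.CompressibleEuler.StrongPointData Literature.Analysis.FluidPDE.CompressibleEuler.EulerPhase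
  Literature.Analysis.FunctionSpaces
open Summit.AtomisticToContinuum.HydrodynamicLimit.Theorems.ChaosClosesEulerShellMeas
  Summit.AtomisticToContinuum.HydrodynamicLimit.Theorems.ChaosClosesEulerShellSlice
  Summit.AtomisticToContinuum.HydrodynamicLimit.Theorems.ChaosClosesEulerShellField
  Summit.AtomisticToContinuum.HydrodynamicLimit.Theorems.ChaosClosesEulerShellFieldB
open Literature.MathematicalPhysics.KineticTheory (T3 V3 totalEnergyDensity)
open scoped InnerProductSpace

/-! ## An order lemma -/

/-- `R ≤ C' F` pointwise with `F, R` integrable gives `∫ R ≤ C' ∫ F` (`integral_mono`, `integral_const_mul`).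
[folklore] -/
theorem integral_le_const_mul_integral {F R : T3 → ℝ} {C' : ℝ} (hF : Integrable F) (hR : Integrable R)
    (h : ∀ x, R x ≤ C' * F x) : ∫ x, R x ≤ C' * ∫ x, F x := by
  rw [← integral_const_mul]
  exact integral_mono hR (hF.const_mul C') h

/-! ## §4 Slice functions, splitting identities, order, measurable version -/

section Split

variable {χe f : ℝ → ℝ} {B T t' CV M N a b : ℝ} {ρ θ : ℝ → T3 → ℝ} {u : ℝ → T3 → V3}
  {V : ℝ → T3 → ℝ × V3 × ℝ}

/-- **The slice functions of `ℰ`.** For `s ∈ [0, t']` the slice `ℰ(s, ·)` is integrable with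
`|∫ₓ ℰ(s, x)| ≤ CV + 6M·CV + CV(N + N max(|a|,|b|)) + N`, and `F(s) = ∫ₓ ℰ(s, x)` is integrable on `[0, t']`.
[folklore] -/
theorem slices_relEnergy (hχc : ContinuousOn χe (Ioi 0)) (hfc : ContinuousOn f (Ioi 0))
    (hcl : IsClassicalEulerSolution (EulerEOS.monatomicExcess χe f) T ρ u θ) (ht' : t' < T)
    (hV : Measurable (uncurry V)) (hV0 : ∀ s x, 0 ≤ (V s x).1) (hVE : ∀ s x, 0 ≤ (V s x).2.2)
    (hVm : ∀ s x, ‖(V s x).2.1‖ ^ 2 ≤ 2 * (V s x).1 * (V s x).2.2)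
    (hCV : ∀ s x, |(V s x).1| ≤ CV ∧ ‖(V s x).2.1‖ ≤ CV ∧ |(V s x).2.2| ≤ CV)
    (hM : ∀ s ∈ Icc 0 t', ∀ x, (pdAt T ρ u θ (s, x)).Bounded M)
    (hN : CoeffBound (EulerEOS.monatomicExcess χe f) T ρ u θ t' N) (hab : a ≤ b) :
    (∀ s ∈ Icc 0 t', Integrable (fun x => (pdAt T ρ u θ (s, x)).relEnergyZ (EulerEOS.monatomicExcess χe f)
        (if 0 < 2 / 3 * ((V s x).2.2 / (V s x).1 - ‖(V s x).2.1‖ ^ 2 / (2 * (V s x).1 ^ 2)) then clamp a b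
          else fun _ => a) ((V s x).1, (V s x).2.2 - ‖(V s x).2.1‖ ^ 2 / (2 * (V s x).1), (V s x).2.1)) ∧
      |∫ x, (pdAt T ρ u θ (s, x)).relEnergyZ (EulerEOS.monatomicExcess χe f)
        (if 0 < 2 / 3 * ((V s x).2.2 / (V s x).1 - ‖(V s x).2.1‖ ^ 2 / (2 * (V s x).1 ^ 2)) then clamp a b
          else fun _ => a) ((V s x).1, (V s x).2.2 - ‖(V s x).2.1‖ ^ 2 / (2 * (V s x).1), (V s x).2.1)| ≤
        CV + 6 * M * CV + CV * (N + N * max |a| |b|) + N) ∧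
    IntegrableOn (fun s => ∫ x, (pdAt T ρ u θ (s, x)).relEnergyZ (EulerEOS.monatomicExcess χe f)
        (if 0 < 2 / 3 * ((V s x).2.2 / (V s x).1 - ‖(V s x).2.1‖ ^ 2 / (2 * (V s x).1 ^ 2)) then clamp a b
          else fun _ => a) ((V s x).1, (V s x).2.2 - ‖(V s x).2.1‖ ^ 2 / (2 * (V s x).1), (V s x).2.1))
      (Icc 0 t') := by
  obtain ⟨hm, hb⟩ := field_relEnergy hχc hfc hcl ht' hV hV0 hVE hVm hCV hM hN hab
  exact slice_pack _ _ _ hm hb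

/-- **The slice functions of `rawRHS + div(p̃ũ)`.** For `s ∈ [0, t']` the slice is integrable with
`|∫ₓ| ≤ N + ((9 + 2B + 4max(|a|,|b|))M + 4N)·2CV + 6MN`, and `s ↦ ∫ₓ (rawRHS + div)(s, x)` is integrable on
`[0, t']`. [folklore] -/
theorem slices_rawRHS (hχc : ContinuousOn χe (Ioi 0)) (hfc : ContinuousOn f (Ioi 0)) (hB : ∀ a, 0 < a → |χe a| ≤ B)
    (hcl : IsClassicalEulerSolution (EulerEOS.monatomicExcess χe f) T ρ u θ) (ht' : t' < T)
    (hV : Measurable (uncurry V)) (hV0 : ∀ s x, 0 ≤ (V s x).1) (hVE : ∀ s x, 0 ≤ (V s x).2.2)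
    (hVm : ∀ s x, ‖(V s x).2.1‖ ^ 2 ≤ 2 * (V s x).1 * (V s x).2.2)
    (hCV : ∀ s x, |(V s x).1| ≤ CV ∧ ‖(V s x).2.1‖ ≤ CV ∧ |(V s x).2.2| ≤ CV)
    (hM : ∀ s ∈ Icc 0 t', ∀ x, (pdAt T ρ u θ (s, x)).Bounded M)
    (hN : CoeffBound (EulerEOS.monatomicExcess χe f) T ρ u θ t' N) (hab : a ≤ b) :
    (∀ s ∈ Icc 0 t', Integrable (fun x => rawRHS (EulerEOS.monatomicExcess χe f)
        (if 0 < 2 / 3 * ((V s x).2.2 / (V s x).1 - ‖(V s x).2.1‖ ^ 2 / (2 * (V s x).1 ^ 2)) then clamp a b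
          else fun _ => a) (pdAt T ρ u θ (s, x)) (V s x).1 ((V s x).2.2 - ‖(V s x).2.1‖ ^ 2 / (2 * (V s x).1))
          (V s x).2.1 + divPU (EulerEOS.monatomicExcess χe f) (pdAt T ρ u θ (s, x))) ∧
      |∫ x, (rawRHS (EulerEOS.monatomicExcess χe f)
        (if 0 < 2 / 3 * ((V s x).2.2 / (V s x).1 - ‖(V s x).2.1‖ ^ 2 / (2 * (V s x).1 ^ 2)) then clamp a b
          else fun _ => a) (pdAt T ρ u θ (s, x)) (V s x).1 ((V s x).2.2 - ‖(V s x).2.1‖ ^ 2 / (2 * (V s x).1))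
          (V s x).2.1 + divPU (EulerEOS.monatomicExcess χe f) (pdAt T ρ u θ (s, x)))| ≤
        N + ((9 + 2 * B + 4 * max |a| |b|) * M + 4 * N) * (2 * CV) + 6 * M * N) ∧
    IntegrableOn (fun s => ∫ x, (rawRHS (EulerEOS.monatomicExcess χe f)
        (if 0 < 2 / 3 * ((V s x).2.2 / (V s x).1 - ‖(V s x).2.1‖ ^ 2 / (2 * (V s x).1 ^ 2)) then clamp a b
          else fun _ => a) (pdAt T ρ u θ (s, x)) (V s x).1 ((V s x).2.2 - ‖(V s x).2.1‖ ^ 2 / (2 * (V s x).1))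
          (V s x).2.1 + divPU (EulerEOS.monatomicExcess χe f) (pdAt T ρ u θ (s, x)))) (Icc 0 t') := by
  obtain ⟨hm, hb⟩ := field_rawRHS hχc hfc hB hcl ht' hV hV0 hVE hVm hCV hM hN hab
  exact slice_pack _ _ _ hm hb

/-- **A measurable version of `F(s) = ∫ₓ ℰ(s, x)` on `[0, t']`.** [folklore] -/
theorem exists_measurable_relEnergy (hχc : ContinuousOn χe (Ioi 0)) (hfc : ContinuousOn f (Ioi 0))
    (hcl : IsClassicalEulerSolution (EulerEOS.monatomicExcess χe f) T ρ u θ) (ht' : t' < T)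
    (hV : Measurable (uncurry V)) (hV0 : ∀ s x, 0 ≤ (V s x).1) (hVE : ∀ s x, 0 ≤ (V s x).2.2)
    (hVm : ∀ s x, ‖(V s x).2.1‖ ^ 2 ≤ 2 * (V s x).1 * (V s x).2.2)
    (hCV : ∀ s x, |(V s x).1| ≤ CV ∧ ‖(V s x).2.1‖ ≤ CV ∧ |(V s x).2.2| ≤ CV)
    (hM : ∀ s ∈ Icc 0 t', ∀ x, (pdAt T ρ u θ (s, x)).Bounded M)
    (hN : CoeffBound (EulerEOS.monatomicExcess χe f) T ρ u θ t' N) (hab : a ≤ b) :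
    ∃ Fm : ℝ → ℝ, Measurable Fm ∧ ∀ s ∈ Icc 0 t', Fm s = ∫ x, (pdAt T ρ u θ (s, x)).relEnergyZ
      (EulerEOS.monatomicExcess χe f)
      (if 0 < 2 / 3 * ((V s x).2.2 / (V s x).1 - ‖(V s x).2.1‖ ^ 2 / (2 * (V s x).1 ^ 2)) then clamp a b
        else fun _ => a) ((V s x).1, (V s x).2.2 - ‖(V s x).2.1‖ ^ 2 / (2 * (V s x).1), (V s x).2.1) :=
  exists_measurable_slice _ _ (field_relEnergy hχc hfc hcl ht' hV hV0 hVE hVm hCV hM hN hab).1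

/-- **Splitting of `F(s) = ∫ₓ ℰ(s, x)`** into the slice integrals of its five pieces (`relEnergyZ_shell_sel`
pointwise, then `∫ (f ± g) = ∫ f ± ∫ g` with the slice integrabilities of §3):
`∫ₓ ℰ = ∫ₓ E - ∫ₓ ũ·m + ∫ₓ φ₁ ϱ - ∫ₓ θ̃ ϱ Zs + ∫ₓ p̃`, for `s ∈ [0, t']`. [folklore] -/
theorem integral_relEnergy_split (hχc : ContinuousOn χe (Ioi 0)) (hfc : ContinuousOn f (Ioi 0))
    (hcl : IsClassicalEulerSolution (EulerEOS.monatomicExcess χe f) T ρ u θ) (ht' : t' < T)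
    (hV : Measurable (uncurry V)) (hV0 : ∀ s x, 0 ≤ (V s x).1) (hVE : ∀ s x, 0 ≤ (V s x).2.2)
    (hVm : ∀ s x, ‖(V s x).2.1‖ ^ 2 ≤ 2 * (V s x).1 * (V s x).2.2)
    (hCV : ∀ s x, |(V s x).1| ≤ CV ∧ ‖(V s x).2.1‖ ≤ CV ∧ |(V s x).2.2| ≤ CV)
    (hM : ∀ s ∈ Icc 0 t', ∀ x, (pdAt T ρ u θ (s, x)).Bounded M)
    (hN : CoeffBound (EulerEOS.monatomicExcess χe f) T ρ u θ t' N) (hab : a ≤ b) {s : ℝ} (hs : s ∈ Icc 0 t') :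
    ∫ x, (pdAt T ρ u θ (s, x)).relEnergyZ (EulerEOS.monatomicExcess χe f)
        (if 0 < 2 / 3 * ((V s x).2.2 / (V s x).1 - ‖(V s x).2.1‖ ^ 2 / (2 * (V s x).1 ^ 2)) then clamp a b
          else fun _ => a) ((V s x).1, (V s x).2.2 - ‖(V s x).2.1‖ ^ 2 / (2 * (V s x).1), (V s x).2.1) =
      (∫ x, (V s x).2.2) - (∫ x, ⟪u s x, (V s x).2.1⟫_ℝ) +
        (∫ x, energyTestFunction (EulerEOS.monatomicExcess χe f) ρ u θ s x * (V s x).1) -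
        (∫ x, θ s x * ((V s x).1 *
          (if 0 < 2 / 3 * ((V s x).2.2 / (V s x).1 - ‖(V s x).2.1‖ ^ 2 / (2 * (V s x).1 ^ 2)) then
            max a (min (3 / 2 * Real.log (2 / 3 * ((V s x).2.2 / (V s x).1 - ‖(V s x).2.1‖ ^ 2 / (2 * (V s x).1 ^ 2))) -
              Real.log (V s x).1 - f (V s x).1) b) else a))) +
        ∫ x, (EulerEOS.monatomicExcess χe f).p (ρ s x) (θ s x) := by
  obtain ⟨mE, bE, mI, bI, mT, bT⟩ := field_linear hχc hfc hcl ht' hV hV0 hVE hVm hCV hM hN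
  obtain ⟨-, -, -, mZ, bZ⟩ := field_entI hχc hfc hcl ht' hV hV0 hVE hVm hCV hM hN hab
  obtain ⟨-, -, -, -, mp, bp⟩ := field_data hχc hfc hcl ht' hM hN
  have iE : Integrable (fun x => (V s x).2.2) := ((slice_pack _ _ _ mE bE).1 s hs).1
  have iI : Integrable (fun x => ⟪u s x, (V s x).2.1⟫_ℝ) := ((slice_pack _ _ _ mI bI).1 s hs).1
  have iT : Integrable (fun x => energyTestFunction (EulerEOS.monatomicExcess χe f) ρ u θ s x * (V s x).1) :=
    ((slice_pack _ _ _ mT bT).1 s hs).1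
  have iZ : Integrable (fun x => θ s x * ((V s x).1 *
      (if 0 < 2 / 3 * ((V s x).2.2 / (V s x).1 - ‖(V s x).2.1‖ ^ 2 / (2 * (V s x).1 ^ 2)) then
        max a (min (3 / 2 * Real.log (2 / 3 * ((V s x).2.2 / (V s x).1 - ‖(V s x).2.1‖ ^ 2 / (2 * (V s x).1 ^ 2))) -
          Real.log (V s x).1 - f (V s x).1) b) else a))) := ((slice_pack _ _ _ mZ bZ).1 s hs).1
  have ip : Integrable (fun x => (EulerEOS.monatomicExcess χe f).p (ρ s x) (θ s x)) :=
    ((slice_pack _ _ _ mp bp).1 s hs).1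
  have hU : ∀ x, (pdAt T ρ u θ (s, x)).U = u s x := fun x => rfl
  have hr : ∀ x, (pdAt T ρ u θ (s, x)).r = ρ s x := fun x => rfl
  have hΘ : ∀ x, (pdAt T ρ u θ (s, x)).Θ = θ s x := fun x => rfl
  have e : ∀ x, (pdAt T ρ u θ (s, x)).relEnergyZ (EulerEOS.monatomicExcess χe f)
      (if 0 < 2 / 3 * ((V s x).2.2 / (V s x).1 - ‖(V s x).2.1‖ ^ 2 / (2 * (V s x).1 ^ 2)) then clamp a b
        else fun _ => a) ((V s x).1, (V s x).2.2 - ‖(V s x).2.1‖ ^ 2 / (2 * (V s x).1), (V s x).2.1) =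
      (V s x).2.2 - ⟪u s x, (V s x).2.1⟫_ℝ + energyTestFunction (EulerEOS.monatomicExcess χe f) ρ u θ s x * (V s x).1 -
        θ s x * ((V s x).1 *
          (if 0 < 2 / 3 * ((V s x).2.2 / (V s x).1 - ‖(V s x).2.1‖ ^ 2 / (2 * (V s x).1 ^ 2)) then
            max a (min (3 / 2 * Real.log (2 / 3 * ((V s x).2.2 / (V s x).1 - ‖(V s x).2.1‖ ^ 2 / (2 * (V s x).1 ^ 2))) -
              Real.log (V s x).1 - f (V s x).1) b) else a)) +
        (EulerEOS.monatomicExcess χe f).p (ρ s x) (θ s x) := fun x => by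
    rw [relEnergyZ_shell_sel, hU, hr, hΘ]
    unfold energyTestFunction
    ring
  rw [integral_congr_ae (ae_of_all _ e), integral_add (((iE.sub' iI).fun_add iT).sub' iZ) ip,
    integral_sub ((iE.sub' iI).fun_add iT) iZ, integral_add (iE.sub' iI) iT, integral_sub iE iI]

/-- **Splitting of `∫ₓ rawRHS(s, x)`** into the slice integrals of the (H2), (H1), (H3) integrands and `∂ₜp̃`
(`rawRHS = -momI + contI - entI + ∂ₜp̃` pointwise with `momI`, `entI` identified by `field_momI`, `field_entI`):
`∫ₓ rawRHS = -∫ₓ (H2) + ∫ₓ contI - ∫ₓ (H3) + ∫ₓ ∂ₜp̃`, and `∫ₓ (rawRHS + div) = ∫ₓ rawRHS + ∫ₓ div`, for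
`s ∈ [0, t']`; the slice `rawRHS(s, ·)` is integrable. [folklore] -/
theorem integral_rawRHS_split (hχc : ContinuousOn χe (Ioi 0)) (hfc : ContinuousOn f (Ioi 0))
    (hB : ∀ a, 0 < a → |χe a| ≤ B)
    (hcl : IsClassicalEulerSolution (EulerEOS.monatomicExcess χe f) T ρ u θ) (ht' : t' < T)
    (hV : Measurable (uncurry V)) (hV0 : ∀ s x, 0 ≤ (V s x).1) (hVE : ∀ s x, 0 ≤ (V s x).2.2)
    (hVm : ∀ s x, ‖(V s x).2.1‖ ^ 2 ≤ 2 * (V s x).1 * (V s x).2.2)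
    (hCV : ∀ s x, |(V s x).1| ≤ CV ∧ ‖(V s x).2.1‖ ≤ CV ∧ |(V s x).2.2| ≤ CV)
    (hM : ∀ s ∈ Icc 0 t', ∀ x, (pdAt T ρ u θ (s, x)).Bounded M)
    (hN : CoeffBound (EulerEOS.monatomicExcess χe f) T ρ u θ t' N) (hab : a ≤ b) {s : ℝ} (hs : s ∈ Icc 0 t') :
    Integrable (fun x => rawRHS (EulerEOS.monatomicExcess χe f)
        (if 0 < 2 / 3 * ((V s x).2.2 / (V s x).1 - ‖(V s x).2.1‖ ^ 2 / (2 * (V s x).1 ^ 2)) then clamp a b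
          else fun _ => a) (pdAt T ρ u θ (s, x)) (V s x).1 ((V s x).2.2 - ‖(V s x).2.1‖ ^ 2 / (2 * (V s x).1))
          (V s x).2.1) ∧
    ((∫ x, rawRHS (EulerEOS.monatomicExcess χe f)
        (if 0 < 2 / 3 * ((V s x).2.2 / (V s x).1 - ‖(V s x).2.1‖ ^ 2 / (2 * (V s x).1 ^ 2)) then clamp a b
          else fun _ => a) (pdAt T ρ u θ (s, x)) (V s x).1 ((V s x).2.2 - ‖(V s x).2.1‖ ^ 2 / (2 * (V s x).1))
          (V s x).2.1) =
      -(∫ x, (⟪Torus.timeDerivWithin (Ico 0 T) u s x, (V s x).2.1⟫_ℝ +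
          ∑ i : Fin 3, ∑ j : Fin 3, Torus.partialDeriv j (fun y => u s y i) x *
            ((V s x).2.1 i * (V s x).2.1 j / (V s x).1 + if i = j then (V s x).1 *
              (2 / 3 * ((V s x).2.2 / (V s x).1 - ‖(V s x).2.1‖ ^ 2 / (2 * (V s x).1 ^ 2))) * χe (V s x).1 else 0))) +
        (∫ x, (pdAt T ρ u θ (s, x)).contI (EulerEOS.monatomicExcess χe f)
          ((V s x).1, (V s x).2.2 - ‖(V s x).2.1‖ ^ 2 / (2 * (V s x).1), (V s x).2.1)) -
        (∫ x, ((V s x).1 * (if 0 < 2 / 3 * ((V s x).2.2 / (V s x).1 - ‖(V s x).2.1‖ ^ 2 / (2 * (V s x).1 ^ 2)) then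
            max a (min (3 / 2 * Real.log (2 / 3 * ((V s x).2.2 / (V s x).1 - ‖(V s x).2.1‖ ^ 2 / (2 * (V s x).1 ^ 2))) -
              Real.log (V s x).1 - f (V s x).1) b) else a) * Torus.timeDerivWithin (Ico 0 T) θ s x +
          (if 0 < 2 / 3 * ((V s x).2.2 / (V s x).1 - ‖(V s x).2.1‖ ^ 2 / (2 * (V s x).1 ^ 2)) then
            max a (min (3 / 2 * Real.log (2 / 3 * ((V s x).2.2 / (V s x).1 - ‖(V s x).2.1‖ ^ 2 / (2 * (V s x).1 ^ 2))) -
              Real.log (V s x).1 - f (V s x).1) b) else a) * ⟪(V s x).2.1, Torus.gradient (θ s) x⟫_ℝ)) +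
        ∫ x, (pdAt T ρ u θ (s, x)).pt (EulerEOS.monatomicExcess χe f)) ∧
    (∫ x, (rawRHS (EulerEOS.monatomicExcess χe f)
        (if 0 < 2 / 3 * ((V s x).2.2 / (V s x).1 - ‖(V s x).2.1‖ ^ 2 / (2 * (V s x).1 ^ 2)) then clamp a b
          else fun _ => a) (pdAt T ρ u θ (s, x)) (V s x).1 ((V s x).2.2 - ‖(V s x).2.1‖ ^ 2 / (2 * (V s x).1))
          (V s x).2.1 + divPU (EulerEOS.monatomicExcess χe f) (pdAt T ρ u θ (s, x)))) =
      (∫ x, rawRHS (EulerEOS.monatomicExcess χe f)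
        (if 0 < 2 / 3 * ((V s x).2.2 / (V s x).1 - ‖(V s x).2.1‖ ^ 2 / (2 * (V s x).1 ^ 2)) then clamp a b
          else fun _ => a) (pdAt T ρ u θ (s, x)) (V s x).1 ((V s x).2.2 - ‖(V s x).2.1‖ ^ 2 / (2 * (V s x).1))
          (V s x).2.1) +
      ∫ x, divPU (EulerEOS.monatomicExcess χe f) (pdAt T ρ u θ (s, x)) := by
  obtain ⟨hidM, mM, bM⟩ := field_momI hχc hfc hB hcl ht' hV hV0 hVE hVm hCV hM
  obtain ⟨mC, bC⟩ := field_contI hχc hfc hcl ht' hV hV0 hVE hVm hCV hN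
  obtain ⟨hidE, mH, bH, -, -⟩ := field_entI hχc hfc hcl ht' hV hV0 hVE hVm hCV hM hN hab
  obtain ⟨mpt, bpt, mdiv, bdiv, -, -⟩ := field_data hχc hfc hcl ht' hM hN
  have iM : Integrable (fun x => ⟪Torus.timeDerivWithin (Ico 0 T) u s x, (V s x).2.1⟫_ℝ +
      ∑ i : Fin 3, ∑ j : Fin 3, Torus.partialDeriv j (fun y => u s y i) x *
        ((V s x).2.1 i * (V s x).2.1 j / (V s x).1 + if i = j then (V s x).1 *
          (2 / 3 * ((V s x).2.2 / (V s x).1 - ‖(V s x).2.1‖ ^ 2 / (2 * (V s x).1 ^ 2))) * χe (V s x).1 else 0)) :=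
    ((slice_pack _ _ _ mM bM).1 s hs).1
  have iC : Integrable (fun x => (pdAt T ρ u θ (s, x)).contI (EulerEOS.monatomicExcess χe f)
      ((V s x).1, (V s x).2.2 - ‖(V s x).2.1‖ ^ 2 / (2 * (V s x).1), (V s x).2.1)) := ((slice_pack _ _ _ mC bC).1 s hs).1
  have iH : Integrable (fun x => (V s x).1 * (if 0 < 2 / 3 * ((V s x).2.2 / (V s x).1 -
      ‖(V s x).2.1‖ ^ 2 / (2 * (V s x).1 ^ 2)) then max a (min (3 / 2 * Real.log (2 / 3 * ((V s x).2.2 / (V s x).1 -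
      ‖(V s x).2.1‖ ^ 2 / (2 * (V s x).1 ^ 2))) - Real.log (V s x).1 - f (V s x).1) b) else a) *
      Torus.timeDerivWithin (Ico 0 T) θ s x +
      (if 0 < 2 / 3 * ((V s x).2.2 / (V s x).1 - ‖(V s x).2.1‖ ^ 2 / (2 * (V s x).1 ^ 2)) then
        max a (min (3 / 2 * Real.log (2 / 3 * ((V s x).2.2 / (V s x).1 - ‖(V s x).2.1‖ ^ 2 / (2 * (V s x).1 ^ 2))) -
          Real.log (V s x).1 - f (V s x).1) b) else a) * ⟪(V s x).2.1, Torus.gradient (θ s) x⟫_ℝ) :=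
    ((slice_pack _ _ _ mH bH).1 s hs).1
  have ipt : Integrable (fun x => (pdAt T ρ u θ (s, x)).pt (EulerEOS.monatomicExcess χe f)) :=
    ((slice_pack _ _ _ mpt bpt).1 s hs).1
  have idiv : Integrable (fun x => divPU (EulerEOS.monatomicExcess χe f) (pdAt T ρ u θ (s, x))) :=
    ((slice_pack _ _ _ mdiv bdiv).1 s hs).1
  -- pointwise splitting
  have e : ∀ x, rawRHS (EulerEOS.monatomicExcess χe f)
      (if 0 < 2 / 3 * ((V s x).2.2 / (V s x).1 - ‖(V s x).2.1‖ ^ 2 / (2 * (V s x).1 ^ 2)) then clamp a b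
        else fun _ => a) (pdAt T ρ u θ (s, x)) (V s x).1 ((V s x).2.2 - ‖(V s x).2.1‖ ^ 2 / (2 * (V s x).1))
        (V s x).2.1 =
      -(⟪Torus.timeDerivWithin (Ico 0 T) u s x, (V s x).2.1⟫_ℝ +
          ∑ i : Fin 3, ∑ j : Fin 3, Torus.partialDeriv j (fun y => u s y i) x *
            ((V s x).2.1 i * (V s x).2.1 j / (V s x).1 + if i = j then (V s x).1 *
              (2 / 3 * ((V s x).2.2 / (V s x).1 - ‖(V s x).2.1‖ ^ 2 / (2 * (V s x).1 ^ 2))) * χe (V s x).1 else 0)) +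
        (pdAt T ρ u θ (s, x)).contI (EulerEOS.monatomicExcess χe f)
          ((V s x).1, (V s x).2.2 - ‖(V s x).2.1‖ ^ 2 / (2 * (V s x).1), (V s x).2.1) -
        ((V s x).1 * (if 0 < 2 / 3 * ((V s x).2.2 / (V s x).1 - ‖(V s x).2.1‖ ^ 2 / (2 * (V s x).1 ^ 2)) then
            max a (min (3 / 2 * Real.log (2 / 3 * ((V s x).2.2 / (V s x).1 - ‖(V s x).2.1‖ ^ 2 / (2 * (V s x).1 ^ 2))) -
              Real.log (V s x).1 - f (V s x).1) b) else a) * Torus.timeDerivWithin (Ico 0 T) θ s x +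
          (if 0 < 2 / 3 * ((V s x).2.2 / (V s x).1 - ‖(V s x).2.1‖ ^ 2 / (2 * (V s x).1 ^ 2)) then
            max a (min (3 / 2 * Real.log (2 / 3 * ((V s x).2.2 / (V s x).1 - ‖(V s x).2.1‖ ^ 2 / (2 * (V s x).1 ^ 2))) -
              Real.log (V s x).1 - f (V s x).1) b) else a) * ⟪(V s x).2.1, Torus.gradient (θ s) x⟫_ℝ) +
        (pdAt T ρ u θ (s, x)).pt (EulerEOS.monatomicExcess χe f) := fun x => by
    have hm := hidM (s, x)
    have he := hidE (s, x)
    dsimp only at hm he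
    rw [rawRHS_shell_pieces, ← hm, ← he]
  have iR : Integrable (fun x => rawRHS (EulerEOS.monatomicExcess χe f)
      (if 0 < 2 / 3 * ((V s x).2.2 / (V s x).1 - ‖(V s x).2.1‖ ^ 2 / (2 * (V s x).1 ^ 2)) then clamp a b
        else fun _ => a) (pdAt T ρ u θ (s, x)) (V s x).1 ((V s x).2.2 - ‖(V s x).2.1‖ ^ 2 / (2 * (V s x).1))
        (V s x).2.1) := (((iM.fun_neg.fun_add iC).sub' iH).fun_add ipt).congr (ae_of_all _ fun x => (e x).symm)
  refine ⟨iR, ?_, integral_add iR idiv⟩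
  rw [integral_congr_ae (ae_of_all _ e), integral_add ((iM.fun_neg.fun_add iC).sub' iH) ipt,
    integral_sub (iM.fun_neg.fun_add iC) iH, integral_add iM.fun_neg iC, integral_neg]

/-- **Order consequences.** If `rawRHS + div(p̃ũ) ≤ C' ℰ` pointwise on the slice `s ∈ [0, t']`, then
`∫ₓ (rawRHS + div) ≤ C' ∫ₓ ℰ` (`integral_mono`, both slices being integrable); and `ℰ ≥ 0` pointwise gives
`0 ≤ ∫ₓ ℰ`. [folklore] -/
theorem integral_rawRHS_le (hχc : ContinuousOn χe (Ioi 0)) (hfc : ContinuousOn f (Ioi 0)) (hB : ∀ a, 0 < a → |χe a| ≤ B)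
    (hcl : IsClassicalEulerSolution (EulerEOS.monatomicExcess χe f) T ρ u θ) (ht' : t' < T)
    (hV : Measurable (uncurry V)) (hV0 : ∀ s x, 0 ≤ (V s x).1) (hVE : ∀ s x, 0 ≤ (V s x).2.2)
    (hVm : ∀ s x, ‖(V s x).2.1‖ ^ 2 ≤ 2 * (V s x).1 * (V s x).2.2)
    (hCV : ∀ s x, |(V s x).1| ≤ CV ∧ ‖(V s x).2.1‖ ≤ CV ∧ |(V s x).2.2| ≤ CV)
    (hM : ∀ s ∈ Icc 0 t', ∀ x, (pdAt T ρ u θ (s, x)).Bounded M)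
    (hN : CoeffBound (EulerEOS.monatomicExcess χe f) T ρ u θ t' N) (hab : a ≤ b) {s : ℝ} (hs : s ∈ Icc 0 t')
    {C' : ℝ} (hle : ∀ x, rawRHS (EulerEOS.monatomicExcess χe f)
        (if 0 < 2 / 3 * ((V s x).2.2 / (V s x).1 - ‖(V s x).2.1‖ ^ 2 / (2 * (V s x).1 ^ 2)) then clamp a b
          else fun _ => a) (pdAt T ρ u θ (s, x)) (V s x).1 ((V s x).2.2 - ‖(V s x).2.1‖ ^ 2 / (2 * (V s x).1))
          (V s x).2.1 + divPU (EulerEOS.monatomicExcess χe f) (pdAt T ρ u θ (s, x)) ≤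
      C' * (pdAt T ρ u θ (s, x)).relEnergyZ (EulerEOS.monatomicExcess χe f)
        (if 0 < 2 / 3 * ((V s x).2.2 / (V s x).1 - ‖(V s x).2.1‖ ^ 2 / (2 * (V s x).1 ^ 2)) then clamp a b
          else fun _ => a) ((V s x).1, (V s x).2.2 - ‖(V s x).2.1‖ ^ 2 / (2 * (V s x).1), (V s x).2.1)) :
    ∫ x, (rawRHS (EulerEOS.monatomicExcess χe f)
        (if 0 < 2 / 3 * ((V s x).2.2 / (V s x).1 - ‖(V s x).2.1‖ ^ 2 / (2 * (V s x).1 ^ 2)) then clamp a b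
          else fun _ => a) (pdAt T ρ u θ (s, x)) (V s x).1 ((V s x).2.2 - ‖(V s x).2.1‖ ^ 2 / (2 * (V s x).1))
          (V s x).2.1 + divPU (EulerEOS.monatomicExcess χe f) (pdAt T ρ u θ (s, x))) ≤
      C' * ∫ x, (pdAt T ρ u θ (s, x)).relEnergyZ (EulerEOS.monatomicExcess χe f)
        (if 0 < 2 / 3 * ((V s x).2.2 / (V s x).1 - ‖(V s x).2.1‖ ^ 2 / (2 * (V s x).1 ^ 2)) then clamp a b
          else fun _ => a) ((V s x).1, (V s x).2.2 - ‖(V s x).2.1‖ ^ 2 / (2 * (V s x).1), (V s x).2.1) := by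
  rw [← integral_const_mul]
  exact integral_mono ((slices_rawRHS hχc hfc hB hcl ht' hV hV0 hVE hVm hCV hM hN hab).1 s hs).1
    (((slices_relEnergy hχc hfc hcl ht' hV hV0 hVE hVm hCV hM hN hab).1 s hs).1.const_mul C') hle

/-- `ℰ ≥ 0` pointwise on a slice gives `0 ≤ ∫ₓ ℰ` (`integral_nonneg`; no integrability needed). [folklore] -/
theorem integral_relEnergy_nonneg {s : ℝ} (h0 : ∀ x, 0 ≤ (pdAt T ρ u θ (s, x)).relEnergyZ (EulerEOS.monatomicExcess χe f)
        (if 0 < 2 / 3 * ((V s x).2.2 / (V s x).1 - ‖(V s x).2.1‖ ^ 2 / (2 * (V s x).1 ^ 2)) then clamp a b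
          else fun _ => a) ((V s x).1, (V s x).2.2 - ‖(V s x).2.1‖ ^ 2 / (2 * (V s x).1), (V s x).2.1)) :
    0 ≤ ∫ x, (pdAt T ρ u θ (s, x)).relEnergyZ (EulerEOS.monatomicExcess χe f)
        (if 0 < 2 / 3 * ((V s x).2.2 / (V s x).1 - ‖(V s x).2.1‖ ^ 2 / (2 * (V s x).1 ^ 2)) then clamp a b
          else fun _ => a) ((V s x).1, (V s x).2.2 - ‖(V s x).2.1‖ ^ 2 / (2 * (V s x).1), (V s x).2.1) :=
  integral_nonneg h0

end Split

section Pieces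

variable {χe f : ℝ → ℝ} {B T t' CV M N a b : ℝ} {ρ θ : ℝ → T3 → ℝ} {u : ℝ → T3 → V3}
  {V : ℝ → T3 → ℝ × V3 × ℝ}

/-- **The slice integrals of the ten pieces are integrable on `[0, t']`**: `∫ₓ E`, `∫ₓ ũ·m`, `∫ₓ φ₁ϱ`,
`∫ₓ θ̃ϱZs`, `∫ₓ p̃` (the pieces of `F`) and `∫ₓ (H2)`, `∫ₓ contI`, `∫ₓ (H3)`, `∫ₓ ∂ₜp̃`, `∫ₓ div(p̃ũ)` (the pieces
of `∫ₓ (rawRHS + div)`), as functions of `s` (§3, §3' with `slice_pack`). [folklore] -/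
theorem integrableOn_pieces (hχc : ContinuousOn χe (Ioi 0)) (hfc : ContinuousOn f (Ioi 0))
    (hB : ∀ a, 0 < a → |χe a| ≤ B)
    (hcl : IsClassicalEulerSolution (EulerEOS.monatomicExcess χe f) T ρ u θ) (ht' : t' < T)
    (hV : Measurable (uncurry V)) (hV0 : ∀ s x, 0 ≤ (V s x).1) (hVE : ∀ s x, 0 ≤ (V s x).2.2)
    (hVm : ∀ s x, ‖(V s x).2.1‖ ^ 2 ≤ 2 * (V s x).1 * (V s x).2.2)
    (hCV : ∀ s x, |(V s x).1| ≤ CV ∧ ‖(V s x).2.1‖ ≤ CV ∧ |(V s x).2.2| ≤ CV)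
    (hM : ∀ s ∈ Icc 0 t', ∀ x, (pdAt T ρ u θ (s, x)).Bounded M)
    (hN : CoeffBound (EulerEOS.monatomicExcess χe f) T ρ u θ t' N) (hab : a ≤ b) :
    IntegrableOn (fun s => ∫ x, (V s x).2.2) (Icc 0 t') ∧
    IntegrableOn (fun s => ∫ x, ⟪u s x, (V s x).2.1⟫_ℝ) (Icc 0 t') ∧
    IntegrableOn (fun s => ∫ x, energyTestFunction (EulerEOS.monatomicExcess χe f) ρ u θ s x * (V s x).1) (Icc 0 t') ∧
    IntegrableOn (fun s => ∫ x, θ s x * ((V s x).1 *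
      (if 0 < 2 / 3 * ((V s x).2.2 / (V s x).1 - ‖(V s x).2.1‖ ^ 2 / (2 * (V s x).1 ^ 2)) then
        max a (min (3 / 2 * Real.log (2 / 3 * ((V s x).2.2 / (V s x).1 - ‖(V s x).2.1‖ ^ 2 / (2 * (V s x).1 ^ 2))) -
          Real.log (V s x).1 - f (V s x).1) b) else a))) (Icc 0 t') ∧
    IntegrableOn (fun s => ∫ x, (EulerEOS.monatomicExcess χe f).p (ρ s x) (θ s x)) (Icc 0 t') ∧
    IntegrableOn (fun s => ∫ x, (⟪Torus.timeDerivWithin (Ico 0 T) u s x, (V s x).2.1⟫_ℝ +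
      ∑ i : Fin 3, ∑ j : Fin 3, Torus.partialDeriv j (fun y => u s y i) x *
        ((V s x).2.1 i * (V s x).2.1 j / (V s x).1 + if i = j then (V s x).1 *
          (2 / 3 * ((V s x).2.2 / (V s x).1 - ‖(V s x).2.1‖ ^ 2 / (2 * (V s x).1 ^ 2))) * χe (V s x).1 else 0)))
      (Icc 0 t') ∧
    IntegrableOn (fun s => ∫ x, (pdAt T ρ u θ (s, x)).contI (EulerEOS.monatomicExcess χe f)
      ((V s x).1, (V s x).2.2 - ‖(V s x).2.1‖ ^ 2 / (2 * (V s x).1), (V s x).2.1)) (Icc 0 t') ∧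
    IntegrableOn (fun s => ∫ x, ((V s x).1 * (if 0 < 2 / 3 * ((V s x).2.2 / (V s x).1 -
      ‖(V s x).2.1‖ ^ 2 / (2 * (V s x).1 ^ 2)) then max a (min (3 / 2 * Real.log (2 / 3 * ((V s x).2.2 / (V s x).1 -
      ‖(V s x).2.1‖ ^ 2 / (2 * (V s x).1 ^ 2))) - Real.log (V s x).1 - f (V s x).1) b) else a) *
      Torus.timeDerivWithin (Ico 0 T) θ s x +
      (if 0 < 2 / 3 * ((V s x).2.2 / (V s x).1 - ‖(V s x).2.1‖ ^ 2 / (2 * (V s x).1 ^ 2)) then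
        max a (min (3 / 2 * Real.log (2 / 3 * ((V s x).2.2 / (V s x).1 - ‖(V s x).2.1‖ ^ 2 / (2 * (V s x).1 ^ 2))) -
          Real.log (V s x).1 - f (V s x).1) b) else a) * ⟪(V s x).2.1, Torus.gradient (θ s) x⟫_ℝ)) (Icc 0 t') ∧
    IntegrableOn (fun s => ∫ x, (pdAt T ρ u θ (s, x)).pt (EulerEOS.monatomicExcess χe f)) (Icc 0 t') ∧
    IntegrableOn (fun s => ∫ x, divPU (EulerEOS.monatomicExcess χe f) (pdAt T ρ u θ (s, x))) (Icc 0 t') := by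
  obtain ⟨mE, bE, mI, bI, mT, bT⟩ := field_linear hχc hfc hcl ht' hV hV0 hVE hVm hCV hM hN
  obtain ⟨-, mM, bM⟩ := field_momI hχc hfc hB hcl ht' hV hV0 hVE hVm hCV hM
  obtain ⟨mC, bC⟩ := field_contI hχc hfc hcl ht' hV hV0 hVE hVm hCV hN
  obtain ⟨-, mH, bH, mZ, bZ⟩ := field_entI hχc hfc hcl ht' hV hV0 hVE hVm hCV hM hN hab
  obtain ⟨mpt, bpt, mdiv, bdiv, mp, bp⟩ := field_data hχc hfc hcl ht' hM hN
  exact ⟨(slice_pack _ _ _ mE bE).2, (slice_pack _ _ _ mI bI).2, (slice_pack _ _ _ mT bT).2,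
    (slice_pack _ _ _ mZ bZ).2, (slice_pack _ _ _ mp bp).2, (slice_pack _ _ _ mM bM).2, (slice_pack _ _ _ mC bC).2,
    (slice_pack _ _ _ mH bH).2, (slice_pack _ _ _ mpt bpt).2, (slice_pack _ _ _ mdiv bdiv).2⟩

end Pieces

/-! ## The registered sub-goal -/

/-- REGISTERED SUB-GOAL `stub_bf18ShellFieldC` of the line `Sketch` (BF18 shell, slice functions of the shell field,
part 3): the order lemma `∫ R ≤ C' ∫ F` for integrable `F, R` on `𝕋³` with `R ≤ C' F` pointwise
(`integral_le_const_mul_integral`). [folklore] -/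
theorem stub_bf18ShellFieldC : ∀ (F R : UnitAddTorus (Fin 3) → ℝ) (C' : ℝ), Integrable F → Integrable R → (∀ x, R x ≤ C' * F x) → ∫ x, R x ≤ C' * ∫ x, F x :=
  fun _F _R _C' hF hR h => integral_le_const_mul_integral hF hR h

end Summit.AtomisticToContinuum.HydrodynamicLimit.Theorems.ChaosClosesEulerShellFieldC

end
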